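import Literature.Analysis.UnboundedOperators.SemigroupLaplaceResolvent
import Mathlib.MeasureTheory.Group.Integral
import Mathlib.MeasureTheory.Integral.IntegralEqImproper
import Mathlib.Analysis.SpecialFunctions.Integrals.Basic
import Mathlib.Analysis.Complex.RealDeriv
import HarnessLib

/-!
# The Laplace transform of an exponentially bounded C₀-semigroup, part 2: the resolvent
  equation (Engel–Nagel II.1.10; Kato IX-§1.3 (1.28)) — `R(λ)` is a pseudo-resolvent on `{Re λ > ω}`

Analysis/UnboundedOperators file continuing `SemigroupLaplaceResolvent.lean` (one definition with
body — the operator family `laplaceResolvent` —, everything proved, no named facts).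

For a C₀-semigroup `T` on a complex Banach space with `‖T(t)‖ ≤ M e^{ωt}` and
`R(λ) x = ∫₀^∞ e^{−λt} T(t) x dt` (`laplaceResolventFun`, part 1), we prove the **resolvent
equation**

  `R(λ) x − R(μ) x = (μ − λ) R(λ) R(μ) x`    (`Re λ, Re μ > ω`),

i.e. `λ ↦ R(λ)` is a pseudo-resolvent on the half-plane (`isPseudoResolvent_laplaceResolvent`),
so that the Riesz-projection calculus of `Literature.Analysis.OperatorTheory.IsPseudoResolvent`
(holomorphy, `P² = P`, eigenvector detection `P v = v`, relatively compact perturbations) applies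
to the resolvents of the closed generators of the semigroups the tree constructs. Engel–Nagel
prove Thm. II.1.10 through the generator (`R(λ) = R(λ, A)`); here the equation is obtained
directly from the semigroup law by a one-variable argument (no Fubini):

* (a)–(c) `T(t) R(μ) x = e^{μt} ( R(μ) x − Φ_μ(t) )`, `Φ_μ(t) = ∫₀ᵗ e^{−μu} T(u) x du`
  (operator through the Bochner integral, semigroup law, translation of the half-line integral,
  splitting `(0,∞) = (0,t] ∪ (t,∞)`): `app_laplaceResolventFun`;
* (d) `d/dt [e^{(μ−λ)t} Φ_μ(t)] = (μ−λ) e^{(μ−λ)t} Φ_μ(t) + e^{−λt} T(t) x` and FTC on `[0, b]`,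
  `b → ∞` (boundary term `→ 0` for `Re μ < Re λ`):
  `(μ − λ) ∫₀^∞ e^{(μ−λ)t} Φ_μ(t) dt = −R(λ) x` (`smul_integral_exp_smul_partial`);
* (e) hence `R(λ)R(μ)x = ∫ e^{(μ−λ)t}(R(μ)x − Φ_μ(t)) dt = (λ−μ)⁻¹(R(μ)x − R(λ)x)` for
  `ω < Re μ < Re λ` (`laplaceResolventFun_sub_of_lt`);
* (f) `R(λ)R(μ) = R(μ)R(λ)` (`laplaceResolventFun_comm`, from `T(t)T(s) = T(s)T(t)`) gives the
  case `Re λ < Re μ`; (g) `λ ↦ R(λ)x` is continuous (dominated convergence,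
  `continuousAt_laplaceResolventFun`), which gives the diagonal `Re λ = Re μ` as a limit from
  `λ + ε`, `ε ↓ 0`; all cases: `laplaceResolventFun_sub`.
* Packaging: `laplaceResolvent T hM : ℂ → E →L[ℂ] E` (the CLM of part 1 on the half-plane, `0`
  outside), `isPseudoResolvent_laplaceResolvent`, and
  `laplaceResolvent_apply_of_app_eq_exp_smul`: `T(t)v = e^{μt}v ⇒ R(λ)v = (λ−μ)⁻¹v`.

## References

* K.-J. Engel, R. Nagel, *One-Parameter Semigroups for Linear Evolution Equations*, Springer GTM
  194 (2000), Ch. II Thm. 1.10 (integral representation of the resolvent; resolvent equation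
  via Ch. IV (1.2)). [EngelNagel2000]
* T. Kato, *Perturbation Theory for Linear Operators* (1966), IX-§1.3 (1.28): "`R(ζ) =
  −∫₀^∞ e^{ζt} U(t) dt` … satisfies the resolvent equation", VIII-§1.1 (pseudo-resolvents).
  [Kato1966]
-/

noncomputable section

open MeasureTheory Set Filter Topology Complex
open scoped NNReal

namespace Literature.Analysis.UnboundedOperators

namespace C0Semigroup

variable {E : Type*} [NormedAddCommGroup E] [NormedSpace ℂ E]

/-! ### Step (a): `T(t)` through the integral and the semigroup law -/

/-- `T(t) (e^{−μs} T(s) x) = e^{μt} e^{−μ(s+t)} T(s + t) x` for `s > 0`. [cite: EngelNagel2000, Ch. II Thm. 1.10] -/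
theorem app_integrand (T : C0Semigroup ℂ E) (μ : ℂ) (x : E) (t : ℝ≥0) {s : ℝ} (hs : 0 < s) :
    T.app t (Complex.exp (-(μ * s)) • T.app (Real.toNNReal s) x) =
      Complex.exp (μ * (t : ℝ)) •
        (Complex.exp (-(μ * ((s + t : ℝ) : ℂ))) • T.app (Real.toNNReal (s + t)) x) := by
  rw [map_smul, smul_smul, ← Complex.exp_add]
  have h1 : T.app t (T.app (Real.toNNReal s) x) = T.app (Real.toNNReal (s + t)) x := by
    rw [← mul_apply_eq_comp, ← app_add, add_comm,
      Real.toNNReal_add hs.le t.coe_nonneg, Real.toNNReal_coe]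
  rw [h1]
  congr 1
  congr 1
  push_cast
  ring

/-- **`T(t) R(μ) x = e^{μt} ∫_{(0,∞)} e^{−μ(s+t)} T(s+t) x ds`** (operator through the Bochner
integral, semigroup law). [cite: EngelNagel2000, Ch. II Thm. 1.10] -/
theorem app_laplaceResolventFun_eq_integral_add [CompleteSpace E] (T : C0Semigroup ℂ E) {M ω : ℝ}
    (hM : ∀ t : ℝ≥0, ‖T.app t‖ ≤ M * Real.exp (ω * t)) {μ : ℂ} (hμ : ω < μ.re) (x : E)
    (t : ℝ≥0) :
    T.app t (T.laplaceResolventFun μ x) =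
      Complex.exp (μ * (t : ℝ)) • ∫ s in Ioi (0 : ℝ),
        Complex.exp (-(μ * ((s + t : ℝ) : ℂ))) • T.app (Real.toNNReal (s + t)) x := by
  rw [laplaceResolventFun, ← (T.app t).integral_comp_comm (integrableOn_integrand T hM hμ x),
    ← integral_smul]
  refine setIntegral_congr_fun measurableSet_Ioi fun s hs => ?_
  exact app_integrand T μ x t hs

/-! ### Step (b): translation on the half-line -/

omit [NormedSpace ℂ E] in
/-- `∫_{(0,∞)} g(s + t) ds = ∫_{(t,∞)} g(u) du` (translation invariance of Lebesgue measure).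
[folklore] -/
theorem setIntegral_Ioi_comp_add_right [NormedSpace ℝ E] (g : ℝ → E) (t : ℝ) :
    ∫ s in Ioi (0 : ℝ), g (s + t) = ∫ u in Ioi t, g u := by
  rw [← MeasureTheory.integral_indicator measurableSet_Ioi,
    ← MeasureTheory.integral_indicator measurableSet_Ioi]
  have h : (fun s : ℝ => (Ioi (0 : ℝ)).indicator (fun s => g (s + t)) s) =
      fun s : ℝ => (Ioi t).indicator g (s + t) := by
    funext s
    by_cases hs : s ∈ Ioi (0 : ℝ)
    · rw [indicator_of_mem hs, indicator_of_mem]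
      simpa using hs
    · rw [indicator_of_notMem hs, indicator_of_notMem]
      simpa using hs
  rw [h]
  exact integral_add_right_eq_self (fun u => (Ioi t).indicator g u) t

/-! ### Step (c): `T(t) R(μ) x = e^{μt} (R(μ) x − ∫₀ᵗ e^{−μu} T(u) x du)` -/

/-- **`T(t) R(μ) x = e^{μt} ( R(μ) x − ∫₀ᵗ e^{−μu} T(u) x du )`** for `t ≥ 0`, `Re μ > ω`.
[cite: EngelNagel2000, Ch. II Thm. 1.10 (proof)] -/
theorem app_laplaceResolventFun [CompleteSpace E] (T : C0Semigroup ℂ E) {M ω : ℝ}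
    (hM : ∀ t : ℝ≥0, ‖T.app t‖ ≤ M * Real.exp (ω * t)) {μ : ℂ} (hμ : ω < μ.re) (x : E)
    (t : ℝ≥0) :
    T.app t (T.laplaceResolventFun μ x) =
      Complex.exp (μ * (t : ℝ)) • (T.laplaceResolventFun μ x -
        ∫ u in (0 : ℝ)..(t : ℝ), Complex.exp (-(μ * u)) • T.app (Real.toNNReal u) x) := by
  rw [app_laplaceResolventFun_eq_integral_add T hM hμ x t]
  congr 1
  rw [setIntegral_Ioi_comp_add_right
    (fun u : ℝ => Complex.exp (-(μ * u)) • T.app (Real.toNNReal u) x) (t : ℝ)]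
  -- split `(0,∞) = (0,t] ∪ (t,∞)`
  have hsplit := (setIntegral_union (Ioc_disjoint_Ioi le_rfl) measurableSet_Ioi
    ((integrableOn_integrand T hM hμ x).mono_set Ioc_subset_Ioi_self)
    ((integrableOn_integrand T hM hμ x).mono_set (Ioi_subset_Ioi t.coe_nonneg)) :
    ∫ u in Ioc (0 : ℝ) t ∪ Ioi (t : ℝ), Complex.exp (-(μ * u)) • T.app (Real.toNNReal u) x = _)
  rw [Ioc_union_Ioi_eq_Ioi t.coe_nonneg] at hsplit
  rw [laplaceResolventFun, hsplit, intervalIntegral.integral_of_le t.coe_nonneg]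
  abel

/-- `0 ≤ M` for any growth bound (`0 ≤ ‖T(0)‖ ≤ M`). [folklore] -/
theorem growthBound_nonneg (T : C0Semigroup ℂ E) {M ω : ℝ}
    (hM : ∀ t : ℝ≥0, ‖T.app t‖ ≤ M * Real.exp (ω * t)) : 0 ≤ M := by
  have h := hM 0
  rw [NNReal.coe_zero, mul_zero, Real.exp_zero, mul_one] at h
  exact (norm_nonneg _).trans h

/-! ### Step (d): integration by parts — `(μ − λ) ∫₀^∞ e^{(μ−λ)t} Φ_μ(t) dt = −R(λ) x` -/

/-- The primitive `Φ_μ(t) = ∫₀ᵗ e^{−μu} T(u) x du` has derivative the integrand (FTC-1, continuous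
integrand). [folklore] -/
theorem hasDerivAt_partial [CompleteSpace E] (T : C0Semigroup ℂ E) (μ : ℂ) (x : E) (t : ℝ) :
    HasDerivAt (fun t : ℝ => ∫ u in (0 : ℝ)..t, Complex.exp (-(μ * u)) • T.app (Real.toNNReal u) x)
      (Complex.exp (-(μ * t)) • T.app (Real.toNNReal t) x) t :=
  intervalIntegral.integral_hasDerivAt_right
    ((continuous_integrand T μ x).intervalIntegrable _ _)
    ((continuous_integrand T μ x).stronglyMeasurableAtFilter _ _)
    (continuous_integrand T μ x).continuousAt

/-- The primitive is continuous. [folklore] -/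
theorem continuous_partial [CompleteSpace E] (T : C0Semigroup ℂ E) (μ : ℂ) (x : E) :
    Continuous fun t : ℝ =>
      ∫ u in (0 : ℝ)..t, Complex.exp (-(μ * u)) • T.app (Real.toNNReal u) x :=
  continuous_iff_continuousAt.2 fun t => (hasDerivAt_partial T μ x t).continuousAt

/-- If `0 ≤ M'` bounds... Uniform bound on the primitive: `‖Φ_μ(t)‖ ≤ M ‖x‖ ∫₀^∞ e^{(ω − Re μ)s} ds`
for `t ≥ 0`, `Re μ > ω`, provided `0 ≤ M` (automatic when `E ≠ 0`). [cite: EngelNagel2000, Ch. II Thm. 1.10 (1.14)] -/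
theorem norm_partial_le (T : C0Semigroup ℂ E) {M ω : ℝ} (hM : ∀ t : ℝ≥0, ‖T.app t‖ ≤ M * Real.exp (ω * t)) {μ : ℂ} (hμ : ω < μ.re) (x : E) {t : ℝ}
    (ht : 0 ≤ t) :
    ‖∫ u in (0 : ℝ)..t, Complex.exp (-(μ * u)) • T.app (Real.toNNReal u) x‖ ≤
      M * ‖x‖ * ∫ s in Ioi (0 : ℝ), Real.exp ((ω - μ.re) * s) := by
  have hM0 : 0 ≤ M := growthBound_nonneg T hM
  rw [intervalIntegral.integral_of_le ht]
  have hint : IntegrableOn (fun u : ℝ => M * ‖x‖ * Real.exp ((ω - μ.re) * u)) (Ioi 0) :=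
    (integrableOn_exp_mul_Ioi (sub_neg.2 hμ) 0).const_mul (M * ‖x‖)
  calc ‖∫ u in Ioc (0 : ℝ) t, Complex.exp (-(μ * u)) • T.app (Real.toNNReal u) x‖
      ≤ ∫ u in Ioc (0 : ℝ) t, M * ‖x‖ * Real.exp ((ω - μ.re) * u) := by
        refine norm_integral_le_of_norm_le (hint.mono_set Ioc_subset_Ioi_self) ?_
        exact (ae_restrict_iff' measurableSet_Ioc).2
          (Eventually.of_forall fun u hu => norm_integrand_le T hM μ x (le_of_lt hu.1))
    _ ≤ ∫ u in Ioi (0 : ℝ), M * ‖x‖ * Real.exp ((ω - μ.re) * u) := by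
        refine setIntegral_mono_set hint ?_ (Eventually.of_forall Ioc_subset_Ioi_self)
        exact Eventually.of_forall fun u => by positivity
    _ = M * ‖x‖ * ∫ s in Ioi (0 : ℝ), Real.exp ((ω - μ.re) * s) := integral_const_mul _ _

/-- The derivative of `t ↦ e^{(μ−λ)t} Φ_μ(t)`:
`(μ − λ) e^{(μ−λ)t} Φ_μ(t) + e^{−λt} T(t) x`. [folklore] -/
theorem hasDerivAt_exp_smul_partial [CompleteSpace E] (T : C0Semigroup ℂ E) (μ l : ℂ) (x : E)
    (t : ℝ) :
    HasDerivAt (fun t : ℝ => Complex.exp ((μ - l) * t) •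
        ∫ u in (0 : ℝ)..t, Complex.exp (-(μ * u)) • T.app (Real.toNNReal u) x)
      ((μ - l) • (Complex.exp ((μ - l) * t) •
          ∫ u in (0 : ℝ)..t, Complex.exp (-(μ * u)) • T.app (Real.toNNReal u) x) +
        Complex.exp (-(l * t)) • T.app (Real.toNNReal t) x) t := by
  have hc : HasDerivAt (fun t : ℝ => Complex.exp ((μ - l) * t))
      ((μ - l) * Complex.exp ((μ - l) * t)) t := by
    have h1 : HasDerivAt (fun y : ℂ => Complex.exp ((μ - l) * y))
        (Complex.exp ((μ - l) * t) * ((μ - l) * 1)) (t : ℂ) :=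
      (Complex.hasDerivAt_exp _).comp (t : ℂ) ((hasDerivAt_id (t : ℂ)).const_mul (μ - l))
    have h2 := h1.comp_ofReal
    convert h2 using 1
    ring
  have h := hc.smul (hasDerivAt_partial T μ x t)
  convert h using 1
  · funext s; rfl
  · rw [add_comm]
    congr 1
    · rw [smul_smul, ← Complex.exp_add]
      congr 1
      ring
    · rw [smul_smul]

/-- FTC-2 on `[0, b]`:
`(μ − λ) ∫₀ᵇ e^{(μ−λ)t} Φ_μ(t) dt = e^{(μ−λ)b} Φ_μ(b) − ∫₀ᵇ e^{−λt} T(t) x dt`. [cite: EngelNagel2000, Ch. II Thm. 1.10 (proof)] -/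
theorem integral_exp_smul_partial_eq [CompleteSpace E] (T : C0Semigroup ℂ E) (μ l : ℂ) (x : E)
    (b : ℝ) :
    (μ - l) • ∫ t in (0 : ℝ)..b, Complex.exp ((μ - l) * t) •
        ∫ u in (0 : ℝ)..t, Complex.exp (-(μ * u)) • T.app (Real.toNNReal u) x =
      Complex.exp ((μ - l) * b) •
          (∫ u in (0 : ℝ)..b, Complex.exp (-(μ * u)) • T.app (Real.toNNReal u) x) -
        ∫ t in (0 : ℝ)..b, Complex.exp (-(l * t)) • T.app (Real.toNNReal t) x := by
  have hcont1 : Continuous fun t : ℝ => Complex.exp ((μ - l) * t) •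
      ∫ u in (0 : ℝ)..t, Complex.exp (-(μ * u)) • T.app (Real.toNNReal u) x :=
    (Complex.continuous_exp.comp (continuous_const.mul Complex.continuous_ofReal)).smul
      (continuous_partial T μ x)
  have hcont2 : Continuous fun t : ℝ => (μ - l) • (Complex.exp ((μ - l) * t) •
      ∫ u in (0 : ℝ)..t, Complex.exp (-(μ * u)) • T.app (Real.toNNReal u) x) :=
    continuous_const.smul hcont1
  have hftc := intervalIntegral.integral_eq_sub_of_hasDerivAt
    (fun t _ => hasDerivAt_exp_smul_partial T μ l x t)
    ((hcont2.add (continuous_integrand T l x)).intervalIntegrable 0 b)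
  simp only [intervalIntegral.integral_same, smul_zero, sub_zero, Complex.ofReal_zero,
    mul_zero] at hftc
  rw [intervalIntegral.integral_add (hcont2.intervalIntegrable 0 b)
    ((continuous_integrand T l x).intervalIntegrable 0 b), intervalIntegral.integral_smul] at hftc
  rw [← hftc]
  abel

/-- The function `t ↦ e^{(μ−λ)t} Φ_μ(t)` is integrable on `(0,∞)` for `ω < Re μ < Re λ`
(`‖Φ_μ‖` is bounded, `norm_partial_le`). [cite: EngelNagel2000, Ch. II Thm. 1.10 (proof)] -/
theorem integrableOn_exp_smul_partial [CompleteSpace E] (T : C0Semigroup ℂ E) {M ω : ℝ}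
    (hM : ∀ t : ℝ≥0, ‖T.app t‖ ≤ M * Real.exp (ω * t)) {μ l : ℂ} (hμ : ω < μ.re)
    (hl : μ.re < l.re) (x : E) :
    IntegrableOn (fun t : ℝ => Complex.exp ((μ - l) * t) •
      ∫ u in (0 : ℝ)..t, Complex.exp (-(μ * u)) • T.app (Real.toNNReal u) x) (Ioi 0) := by
  set C : ℝ := M * ‖x‖ * ∫ s in Ioi (0 : ℝ), Real.exp ((ω - μ.re) * s) with hC
  have hcont : Continuous fun t : ℝ => Complex.exp ((μ - l) * t) •
      ∫ u in (0 : ℝ)..t, Complex.exp (-(μ * u)) • T.app (Real.toNNReal u) x :=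
    (Complex.continuous_exp.comp (continuous_const.mul Complex.continuous_ofReal)).smul
      (continuous_partial T μ x)
  refine Integrable.mono' ((integrableOn_exp_mul_Ioi (sub_neg.2 hl) 0).mul_const C)
    hcont.aestronglyMeasurable ?_
  refine (ae_restrict_iff' measurableSet_Ioi).2 (Eventually.of_forall fun t ht => ?_)
  rw [norm_smul, Complex.norm_exp]
  have hre : ((μ - l) * (t : ℂ)).re = (μ.re - l.re) * t := by
    simp [Complex.mul_re, Complex.ofReal_re, Complex.ofReal_im]
  rw [hre]
  exact mul_le_mul_of_nonneg_left (norm_partial_le T hM hμ x (le_of_lt ht)) (Real.exp_pos _).le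

/-- **`(μ − λ) ∫₀^∞ e^{(μ−λ)t} Φ_μ(t) dt = −R(λ) x`** for `ω < Re μ < Re λ` (let `b → ∞` in
`integral_exp_smul_partial_eq`: the boundary term `e^{(μ−λ)b} Φ_μ(b) → 0`).
[cite: EngelNagel2000, Ch. II Thm. 1.10 (proof)] -/
theorem smul_integral_exp_smul_partial [CompleteSpace E] (T : C0Semigroup ℂ E) {M ω : ℝ}
    (hM : ∀ t : ℝ≥0, ‖T.app t‖ ≤ M * Real.exp (ω * t)) {μ l : ℂ} (hμ : ω < μ.re)
    (hl : μ.re < l.re) (x : E) :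
    (μ - l) • (∫ t in Ioi (0 : ℝ), Complex.exp ((μ - l) * t) •
        ∫ u in (0 : ℝ)..t, Complex.exp (-(μ * u)) • T.app (Real.toNNReal u) x) =
      -T.laplaceResolventFun l x := by
  have hωl : ω < l.re := hμ.trans hl
  -- the three limits as `b → ∞`
  have hlim1 : Tendsto (fun b : ℝ => (μ - l) • ∫ t in (0 : ℝ)..b, Complex.exp ((μ - l) * t) •
      ∫ u in (0 : ℝ)..t, Complex.exp (-(μ * u)) • T.app (Real.toNNReal u) x) atTop
      (𝓝 ((μ - l) • ∫ t in Ioi (0 : ℝ), Complex.exp ((μ - l) * t) •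
        ∫ u in (0 : ℝ)..t, Complex.exp (-(μ * u)) • T.app (Real.toNNReal u) x)) :=
    (intervalIntegral_tendsto_integral_Ioi 0 (integrableOn_exp_smul_partial T hM hμ hl x)
      tendsto_id).const_smul _
  have hlim2 : Tendsto (fun b : ℝ => ∫ t in (0 : ℝ)..b,
      Complex.exp (-(l * t)) • T.app (Real.toNNReal t) x) atTop (𝓝 (T.laplaceResolventFun l x)) :=
    intervalIntegral_tendsto_integral_Ioi 0 (integrableOn_integrand T hM hωl x) tendsto_id
  have hlim3 : Tendsto (fun b : ℝ => Complex.exp ((μ - l) * b) •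
      ∫ u in (0 : ℝ)..b, Complex.exp (-(μ * u)) • T.app (Real.toNNReal u) x) atTop (𝓝 0) := by
    set C : ℝ := M * ‖x‖ * ∫ s in Ioi (0 : ℝ), Real.exp ((ω - μ.re) * s) with hC
    have hexp : Tendsto (fun b : ℝ => Real.exp ((μ.re - l.re) * b) * C) atTop (𝓝 0) := by
      have h0 : Tendsto (fun b : ℝ => Real.exp ((μ.re - l.re) * b)) atTop (𝓝 0) :=
        Real.tendsto_exp_atBot.comp
          (tendsto_id.const_mul_atTop_of_neg (sub_neg.2 hl))
      simpa using h0.mul_const C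
    refine squeeze_zero_norm' ?_ hexp
    filter_upwards [eventually_ge_atTop (0 : ℝ)] with b hb
    rw [norm_smul, Complex.norm_exp]
    have hre : ((μ - l) * (b : ℂ)).re = (μ.re - l.re) * b := by
      simp [Complex.mul_re, Complex.ofReal_re, Complex.ofReal_im]
    rw [hre]
    exact mul_le_mul_of_nonneg_left (norm_partial_le T hM hμ x hb) (Real.exp_pos _).le
  have hlim4 := hlim3.sub hlim2
  rw [zero_sub] at hlim4
  have heq : (fun b : ℝ => (μ - l) • ∫ t in (0 : ℝ)..b, Complex.exp ((μ - l) * t) •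
      ∫ u in (0 : ℝ)..t, Complex.exp (-(μ * u)) • T.app (Real.toNNReal u) x) =
      fun b : ℝ => Complex.exp ((μ - l) * b) •
          (∫ u in (0 : ℝ)..b, Complex.exp (-(μ * u)) • T.app (Real.toNNReal u) x) -
        ∫ t in (0 : ℝ)..b, Complex.exp (-(l * t)) • T.app (Real.toNNReal t) x := by
    funext b
    exact integral_exp_smul_partial_eq T μ l x b
  rw [heq] at hlim1
  exact tendsto_nhds_unique hlim1 hlim4

/-! ### Step (e): the resolvent equation for `ω < Re μ < Re λ` -/

/-- **`R(λ) R(μ) x = (λ − μ)⁻¹ (R(μ) x − R(λ) x)`** for `ω < Re μ < Re λ`.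
[cite: EngelNagel2000, Ch. II Thm. 1.10; Kato1966 IX-§1.3 (1.28)] -/
theorem laplaceResolventFun_laplaceResolventFun_of_lt [CompleteSpace E] (T : C0Semigroup ℂ E)
    {M ω : ℝ} (hM : ∀ t : ℝ≥0, ‖T.app t‖ ≤ M * Real.exp (ω * t)) {μ l : ℂ}
    (hμ : ω < μ.re) (hl : μ.re < l.re) (x : E) :
    T.laplaceResolventFun l (T.laplaceResolventFun μ x) =
      (l - μ)⁻¹ • (T.laplaceResolventFun μ x - T.laplaceResolventFun l x) := by
  have hωl : ω < l.re := hμ.trans hl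
  have hne : (l - μ : ℂ) ≠ 0 := fun h => by
    have := congrArg Complex.re h
    simp at this
    linarith
  -- rewrite the outer integrand using `T(t) R(μ) x = e^{μt}(R(μ)x − Φ_μ(t))`
  have hpt : ∀ t ∈ Ioi (0 : ℝ),
      Complex.exp (-(l * t)) • T.app (Real.toNNReal t) (T.laplaceResolventFun μ x) =
        Complex.exp ((μ - l) * t) • T.laplaceResolventFun μ x -
          Complex.exp ((μ - l) * t) •
            ∫ u in (0 : ℝ)..t, Complex.exp (-(μ * u)) • T.app (Real.toNNReal u) x := by
    intro t ht
    rw [app_laplaceResolventFun T hM hμ x, Real.coe_toNNReal t (le_of_lt ht), smul_smul,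
      ← Complex.exp_add, smul_sub]
    congr 1 <;> congr 1 <;> ring_nf
  have hint1 : IntegrableOn (fun t : ℝ => Complex.exp ((μ - l) * t) • T.laplaceResolventFun μ x)
      (Ioi 0) :=
    (integrableOn_exp_mul_complex_Ioi (by simpa using hl) 0).smul_const _
  have hint2 := integrableOn_exp_smul_partial T hM hμ hl x
  calc T.laplaceResolventFun l (T.laplaceResolventFun μ x)
      = ∫ t in Ioi (0 : ℝ), (Complex.exp ((μ - l) * t) • T.laplaceResolventFun μ x -
          Complex.exp ((μ - l) * t) •
            ∫ u in (0 : ℝ)..t, Complex.exp (-(μ * u)) • T.app (Real.toNNReal u) x) := by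
        rw [laplaceResolventFun]
        exact setIntegral_congr_fun measurableSet_Ioi hpt
    _ = (∫ t in Ioi (0 : ℝ), Complex.exp ((μ - l) * t) • T.laplaceResolventFun μ x) -
          ∫ t in Ioi (0 : ℝ), Complex.exp ((μ - l) * t) •
            ∫ u in (0 : ℝ)..t, Complex.exp (-(μ * u)) • T.app (Real.toNNReal u) x :=
        integral_sub hint1 hint2
    _ = (l - μ)⁻¹ • T.laplaceResolventFun μ x - (l - μ)⁻¹ • T.laplaceResolventFun l x := by
        congr 1
        · rw [integral_smul_const, integral_exp_mul_complex_Ioi (by simpa using hl) 0]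
          congr 1
          rw [Complex.ofReal_zero, mul_zero, Complex.exp_zero, neg_div, one_div, ← inv_neg,
            neg_sub]
        · have h := smul_integral_exp_smul_partial T hM hμ hl x
          have hne' : (μ - l : ℂ) ≠ 0 := fun h' => hne (by rw [← neg_sub, h', neg_zero])
          have h2 := congrArg (fun v => (μ - l)⁻¹ • v) h
          simp only [smul_smul, inv_mul_cancel₀ hne', one_smul, smul_neg] at h2
          rw [h2, ← neg_smul, ← inv_neg, neg_sub]
    _ = (l - μ)⁻¹ • (T.laplaceResolventFun μ x - T.laplaceResolventFun l x) := by
        rw [smul_sub]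

/-- **The resolvent equation, ordered case**: `R(λ) x − R(μ) x = (μ − λ) R(λ) R(μ) x` for
`ω < Re μ < Re λ`. [cite: EngelNagel2000, Ch. II Thm. 1.10; Kato1966 IX-§1.3 (1.28)] -/
theorem laplaceResolventFun_sub_of_lt [CompleteSpace E] (T : C0Semigroup ℂ E) {M ω : ℝ}
    (hM : ∀ t : ℝ≥0, ‖T.app t‖ ≤ M * Real.exp (ω * t)) {μ l : ℂ} (hμ : ω < μ.re)
    (hl : μ.re < l.re) (x : E) :
    T.laplaceResolventFun l x - T.laplaceResolventFun μ x =
      (μ - l) • T.laplaceResolventFun l (T.laplaceResolventFun μ x) := by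
  have hne : (l - μ : ℂ) ≠ 0 := fun h => by
    have := congrArg Complex.re h
    simp at this
    linarith
  rw [laplaceResolventFun_laplaceResolventFun_of_lt T hM hμ hl x, smul_smul,
    show (μ - l) * (l - μ)⁻¹ = -1 by
      rw [← neg_sub l μ, neg_mul, mul_inv_cancel₀ hne],
    neg_one_smul, neg_sub]

/-! ### Step (f): commutativity and the reverse-ordered case -/

/-- `T(t)` commutes with `R(μ)`: `T(t) R(μ) x = R(μ) T(t) x`. [cite: EngelNagel2000, Ch. II Lemma 1.3 / Thm. 1.10] -/
theorem app_laplaceResolventFun_comm [CompleteSpace E] (T : C0Semigroup ℂ E) {M ω : ℝ}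
    (hM : ∀ t : ℝ≥0, ‖T.app t‖ ≤ M * Real.exp (ω * t)) {μ : ℂ} (hμ : ω < μ.re) (x : E)
    (t : ℝ≥0) :
    T.app t (T.laplaceResolventFun μ x) = T.laplaceResolventFun μ (T.app t x) := by
  rw [laplaceResolventFun, ← (T.app t).integral_comp_comm (integrableOn_integrand T hM hμ x),
    laplaceResolventFun]
  congr 1
  funext s
  rw [map_smul, ← mul_apply_eq_comp, app_comm, mul_apply_eq_comp]

/-- **`R(λ)` and `R(μ)` commute** (`Re λ, Re μ > ω`). [cite: EngelNagel2000, Ch. II Thm. 1.10; Kato1966 IX-§1.3] -/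
theorem laplaceResolventFun_comm [CompleteSpace E] (T : C0Semigroup ℂ E) {M ω : ℝ}
    (hM : ∀ t : ℝ≥0, ‖T.app t‖ ≤ M * Real.exp (ω * t)) {l μ : ℂ} (hl : ω < l.re) (hμ : ω < μ.re)
    (x : E) :
    T.laplaceResolventFun l (T.laplaceResolventFun μ x) =
      T.laplaceResolventFun μ (T.laplaceResolventFun l x) := by
  calc T.laplaceResolventFun l (T.laplaceResolventFun μ x)
      = ∫ t in Ioi (0 : ℝ), T.laplaceResolventCLM hM hμ
          (Complex.exp (-(l * t)) • T.app (Real.toNNReal t) x) := by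
        rw [laplaceResolventFun]
        congr 1
        funext t
        rw [app_laplaceResolventFun_comm T hM hμ x, laplaceResolventCLM_apply,
          laplaceResolventFun_smul]
    _ = T.laplaceResolventCLM hM hμ (∫ t in Ioi (0 : ℝ),
          Complex.exp (-(l * t)) • T.app (Real.toNNReal t) x) :=
        (T.laplaceResolventCLM hM hμ).integral_comp_comm (integrableOn_integrand T hM hl x)
    _ = T.laplaceResolventFun μ (T.laplaceResolventFun l x) := rfl

/-- The resolvent equation in the reverse-ordered case `ω < Re λ < Re μ` (from the ordered case
and commutativity). [cite: EngelNagel2000, Ch. II Thm. 1.10; Kato1966 IX-§1.3 (1.28)] -/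
theorem laplaceResolventFun_sub_of_gt [CompleteSpace E] (T : C0Semigroup ℂ E) {M ω : ℝ}
    (hM : ∀ t : ℝ≥0, ‖T.app t‖ ≤ M * Real.exp (ω * t)) {μ l : ℂ} (hl : ω < l.re)
    (hμ : l.re < μ.re) (x : E) :
    T.laplaceResolventFun l x - T.laplaceResolventFun μ x =
      (μ - l) • T.laplaceResolventFun l (T.laplaceResolventFun μ x) := by
  have h := laplaceResolventFun_sub_of_lt T hM hl hμ x
  rw [laplaceResolventFun_comm T hM (hl.trans hμ) hl x] at h
  rw [← neg_sub, h, ← neg_smul, neg_sub]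

/-! ### Step (g): continuity in `λ` and the diagonal case `Re λ = Re μ` -/

/-- **`λ ↦ R(λ) x` is continuous on `{Re λ > ω}`** (dominated convergence). [cite: EngelNagel2000, Ch. II Thm. 1.10] -/
theorem continuousAt_laplaceResolventFun (T : C0Semigroup ℂ E) {M ω : ℝ}
    (hM : ∀ t : ℝ≥0, ‖T.app t‖ ≤ M * Real.exp (ω * t)) {l : ℂ} (hl : ω < l.re) (x : E) :
    ContinuousAt (fun l' : ℂ => T.laplaceResolventFun l' x) l := by
  -- on the neighbourhood `{Re l' > (ω + Re l)/2}` the integrands are dominated by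
  -- `M ‖x‖ e^{(ω − (ω + Re l)/2) t}`
  set m : ℝ := (ω + l.re) / 2 with hm
  have hωm : ω < m := by rw [hm]; linarith
  have hml : m < l.re := by rw [hm]; linarith
  have hnhds : ∀ᶠ l' : ℂ in 𝓝 l, m < l'.re :=
    Complex.continuous_re.continuousAt.eventually (Ioi_mem_nhds hml)
  simp only [laplaceResolventFun]
  refine continuousAt_of_dominated (bound := fun t : ℝ => M * ‖x‖ * Real.exp ((ω - m) * t))
    (Eventually.of_forall fun l' => (continuous_integrand T l' x).aestronglyMeasurable) ?_
    ((integrableOn_exp_mul_Ioi (sub_neg.2 hωm) 0).const_mul (M * ‖x‖)) ?_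
  · filter_upwards [hnhds] with l' hl'
    refine (ae_restrict_iff' measurableSet_Ioi).2 (Eventually.of_forall fun t ht => ?_)
    refine (norm_integrand_le T hM l' x (le_of_lt ht)).trans ?_
    have hMx : 0 ≤ M * ‖x‖ := mul_nonneg (growthBound_nonneg T hM) (norm_nonneg x)
    refine mul_le_mul_of_nonneg_left (Real.exp_le_exp.2 ?_) hMx
    exact mul_le_mul_of_nonneg_right (by linarith) (le_of_lt ht)
  · refine Eventually.of_forall fun t => ?_
    exact ((Complex.continuous_exp.comp
      ((continuous_id.mul continuous_const).neg)).smul continuous_const).continuousAt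

/-- **The resolvent equation for `ω < Re μ ≤ Re λ`** (the diagonal `Re λ = Re μ` by continuity
from `λ + ε`, `ε ↓ 0`). [cite: EngelNagel2000, Ch. II Thm. 1.10; Kato1966 IX-§1.3 (1.28)] -/
theorem laplaceResolventFun_sub_of_le [CompleteSpace E] (T : C0Semigroup ℂ E) {M ω : ℝ}
    (hM : ∀ t : ℝ≥0, ‖T.app t‖ ≤ M * Real.exp (ω * t)) {μ l : ℂ} (hμ : ω < μ.re)
    (hl : μ.re ≤ l.re) (x : E) :
    T.laplaceResolventFun l x - T.laplaceResolventFun μ x =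
      (μ - l) • T.laplaceResolventFun l (T.laplaceResolventFun μ x) := by
  have hωl : ω < l.re := lt_of_lt_of_le hμ hl
  -- both sides along `l + ε`, `ε → 0⁺`
  have hid : ∀ ε : ℝ, 0 < ε →
      T.laplaceResolventFun (l + ε) x - T.laplaceResolventFun μ x =
        (μ - (l + ε)) • T.laplaceResolventFun (l + ε) (T.laplaceResolventFun μ x) := by
    intro ε hε
    refine laplaceResolventFun_sub_of_lt T hM hμ ?_ x
    simp only [Complex.add_re, Complex.ofReal_re]
    linarith
  have htend : Tendsto (fun ε : ℝ => (l + ε : ℂ)) (𝓝[>] 0) (𝓝 l) := by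
    have h : Tendsto (fun ε : ℝ => (l + ε : ℂ)) (𝓝 0) (𝓝 (l + (0 : ℝ))) :=
      (continuous_const.add Complex.continuous_ofReal).continuousAt.tendsto
    rw [Complex.ofReal_zero, add_zero] at h
    exact h.mono_left nhdsWithin_le_nhds
  have hL : Tendsto (fun ε : ℝ => T.laplaceResolventFun (l + ε) x - T.laplaceResolventFun μ x)
      (𝓝[>] 0) (𝓝 (T.laplaceResolventFun l x - T.laplaceResolventFun μ x)) :=
    ((continuousAt_laplaceResolventFun T hM hωl x).tendsto.comp htend).sub_const _
  have hR : Tendsto (fun ε : ℝ =>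
      (μ - (l + ε)) • T.laplaceResolventFun (l + ε) (T.laplaceResolventFun μ x))
      (𝓝[>] 0) (𝓝 ((μ - l) • T.laplaceResolventFun l (T.laplaceResolventFun μ x))) :=
    ((continuous_const.sub continuous_id).continuousAt.tendsto.comp htend).smul
      ((continuousAt_laplaceResolventFun T hM hωl _).tendsto.comp htend)
  have heq : (fun ε : ℝ => T.laplaceResolventFun (l + ε) x - T.laplaceResolventFun μ x)
      =ᶠ[𝓝[>] 0] fun ε : ℝ =>
        (μ - (l + ε)) • T.laplaceResolventFun (l + ε) (T.laplaceResolventFun μ x) :=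
    eventually_nhdsWithin_of_forall fun ε hε => hid ε hε
  exact tendsto_nhds_unique (hL.congr' heq) hR

/-- **The resolvent equation** `R(λ) x − R(μ) x = (μ − λ) R(λ) R(μ) x` for all `λ, μ` with
`Re λ, Re μ > ω`. [cite: EngelNagel2000, Ch. II Thm. 1.10; Kato1966 IX-§1.3 (1.28)] -/
theorem laplaceResolventFun_sub [CompleteSpace E] (T : C0Semigroup ℂ E) {M ω : ℝ}
    (hM : ∀ t : ℝ≥0, ‖T.app t‖ ≤ M * Real.exp (ω * t)) {l μ : ℂ} (hl : ω < l.re)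
    (hμ : ω < μ.re) (x : E) :
    T.laplaceResolventFun l x - T.laplaceResolventFun μ x =
      (μ - l) • T.laplaceResolventFun l (T.laplaceResolventFun μ x) := by
  rcases le_or_gt μ.re l.re with h | h
  · exact laplaceResolventFun_sub_of_le T hM hμ h x
  · exact laplaceResolventFun_sub_of_gt T hM hl h x

/-! ### The pseudo-resolvent `λ ↦ R(λ)` on `{Re λ > ω}` -/

/-- **The Laplace-transform resolvent family** `λ ↦ R(λ) ∈ 𝓑(E)` on `{Re λ > ω}` (extended by
`0` elsewhere). [cite: EngelNagel2000, Ch. II Thm. 1.10] -/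
def laplaceResolvent (T : C0Semigroup ℂ E) {M ω : ℝ}
    (hM : ∀ t : ℝ≥0, ‖T.app t‖ ≤ M * Real.exp (ω * t)) (l : ℂ) : E →L[ℂ] E :=
  if h : ω < l.re then T.laplaceResolventCLM hM h else 0

/-- On the half-plane, `laplaceResolvent` acts as the Laplace integral. [cite: EngelNagel2000, Ch. II Thm. 1.10 (1.13)] -/
theorem laplaceResolvent_apply (T : C0Semigroup ℂ E) {M ω : ℝ}
    (hM : ∀ t : ℝ≥0, ‖T.app t‖ ≤ M * Real.exp (ω * t)) {l : ℂ} (hl : ω < l.re) (x : E) :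
    T.laplaceResolvent hM l x = T.laplaceResolventFun l x := by
  rw [laplaceResolvent, dif_pos hl, laplaceResolventCLM_apply]

/-- **Engel–Nagel II.1.10 / Kato IX-(1.28): the Laplace transform of an exponentially bounded
C₀-semigroup is a pseudo-resolvent on `{Re λ > ω}`** — `R(λ) − R(μ) = (μ − λ) R(λ) R(μ)`; hence
the whole Riesz-projection calculus of `Literature.Analysis.OperatorTheory.IsPseudoResolvent`
(holomorphy, contour integrals, eigenvector detection, compact perturbations) applies to it.
[cite: EngelNagel2000, Ch. II Thm. 1.10; Kato1966 IX-§1.3 (1.28) and VIII-§1.1] -/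
theorem isPseudoResolvent_laplaceResolvent [CompleteSpace E] (T : C0Semigroup ℂ E) {M ω : ℝ}
    (hM : ∀ t : ℝ≥0, ‖T.app t‖ ≤ M * Real.exp (ω * t)) :
    Literature.Analysis.OperatorTheory.IsPseudoResolvent {l : ℂ | ω < l.re}
      (T.laplaceResolvent hM) := by
  intro z hz w hw
  ext x
  simp only [FunLike.coe_sub, FunLike.coe_smul, Pi.sub_apply, Pi.smul_apply, mul_apply_eq_comp, laplaceResolvent_apply T hM hz,
    laplaceResolvent_apply T hM hw]
  exact laplaceResolventFun_sub T hM hz hw x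

/-- The half-plane `{Re λ > ω}` is open. [folklore] -/
theorem isOpen_setOf_lt_re (ω : ℝ) : IsOpen {l : ℂ | ω < l.re} :=
  isOpen_lt continuous_const Complex.continuous_re

/-- **Eigenvectors of the semigroup are resolvent-eigenvectors of the pseudo-resolvent**:
`T(t) v = e^{μt} v` (all `t ≥ 0`) gives `R(λ) v = (λ − μ)⁻¹ v` for `Re λ > max(ω, Re μ)` — the
hypothesis of `IsPseudoResolvent.circleIntegral_apply_of_apply_eq_inv_smul` /
`circleIntegral_ne_zero_of_apply_eq_inv_smul` (Riesz projection `P v = v ≠ 0`).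
[cite: EngelNagel2000, Ch. II Thm. 1.10 and Ch. IV §3 (point spectrum)] -/
theorem laplaceResolvent_apply_of_app_eq_exp_smul [CompleteSpace E] (T : C0Semigroup ℂ E)
    {M ω : ℝ} (hM : ∀ t : ℝ≥0, ‖T.app t‖ ≤ M * Real.exp (ω * t)) {μ : ℂ} {v : E}
    (hv : ∀ t : ℝ≥0, T.app t v = Complex.exp (μ * t) • v) {l : ℂ} (hl : ω < l.re)
    (hμl : μ.re < l.re) :
    T.laplaceResolvent hM l v = (l - μ)⁻¹ • v := by
  rw [laplaceResolvent_apply T hM hl, laplaceResolventFun_of_app_eq_exp_smul T hv hμl]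

end C0Semigroup

end Literature.Analysis.UnboundedOperators
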